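import Summits.QuantumFields.BalabanUV.Beta.GAN24.DerivativeRateTransferJensenMassFreeTransferWeighted

/-!
# `BalabanUV.Beta.GAN24.DerivativeRateTransferJensenMassFreeWeightedGram` — binder row G-an2-4 ∕ (CONV-C), route R6 «VALUES, NOT DERIVATIVES», PART 91:
# LOCAL MASS × COLUMN DECAY ⟹ THE WEIGHTED-MASS SCHEDULE — the junction feeding PART 90 §3's only tower input: the `D_τ`-weighted Gram entry of the one-step block
# means `M = Qf·ℋ′` of the unit-source minimiser columns is bounded by `C²·S·m` from (i) a LOCAL (per-cube) bound `m` on the weight `Σ_{p ∈ cube} D_τ(p) ≤ m`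
# (R9°'s squeeze LOCALISED, in RMS currency: two powers of the level ratio in the energy normalisation) and (ii) a k-UNIFORM column profile
# `|M(p,a)| ≤ C·ρ_a(cube p)` with `ρ ≤ 1` and `Σ_cubes ρ_a ≤ S` (the (H2)-class decay of the minimisers, [CMP 99-bg] Thm 3.1-type — a HYPOTHESIS here); along the
# tower `m_j ≤ m₀·(θ²)^j` gives PART 90's `hW` with `W₀ = C²·S·m₀` — volume-free (unit b2b-balaban-gan24-p3, gen 47; v1 — the LOCALISATION word of gan24-idea-1
# g63 LENS 20 (F) ∕ g64 LENS 21, typed as bookkeeping)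

NOT IN PRINT; OUR PROOF (for the ROUTE; [folklore] finite sums).  HONEST FRAMING (cell contract, verbatim): «discharging `BetaPertH` makes Bałaban's UV stability
UNCONDITIONAL — a real constructive-QFT result; it is NOT the continuum limit and NOT the Clay problem.»  HONEST DEPENDENCY (verbatim): «continuum YM on T⁴ ⇐ BetaPertH ∧
nine spine estimates (0/9 proved); BetaPertH ⇐ (D1) ∧ (D4) ∧ CAP+tail; G-an2-4 gates asym, D1 and NE2/3/4.»

WHY THIS FILE.  PART 90 §3 (`towerEnd_of_weightedMassSchedule`) reduces PART 20's END to ONE tower letter, `|(ℋ_jᵀ G_j ℋ_j)_{ab}| ≤ W₀·(θ²)^j` with the weighted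
carrier `G_{j+1} = Qf_jᵀ D_{τ,j} Qf_j` (§1: `ℋ′ᵀ(QfᵀDQf)ℋ′ = (Qfℋ′)ᵀD(Qfℋ′)`, entry `Σ_p D(p)·M(p,a)M(p,b)`).  A GLOBAL mass `Σ_p D(p)` is extensive (gan24-idea-1 g63
LENS 20 (F): «M₀ ∝ vol^{1∕6} … at CONSUMER grade the global squeeze is NOT enough: the mass must be LOCALISED»); the honest volume-free input is a bound PER UNIT
CUBE together with the decay of the columns across cubes — §2 is that junction, §3 its schedule form.

WHAT THIS FILE PROVES (0 sorry, 0 `def`, nothing cited):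
* §1 `gram_comp` (`ℋ′ᵀ(Qfᵀ·D·Qf)ℋ′ = (Qfℋ′)ᵀ·D·(Qfℋ′)`), `gram_diagonal_apply` (`(MᵀDM)_{ab} = Σ_p D(p)·M(p,a)·M(p,b)` for diagonal `D`).
* §2 **`abs_gram_diagonal_le_of_colDecay_of_localMass`**: `0 ≤ D`, cubes `blk : μ → K`, `Σ_{p : blk p.1 = k} D(p) ≤ m` for every cube (`0 ≤ m`), columns
  `|M(p,a)| ≤ C·ρ_a(blk p.1)` with `0 ≤ ρ ≤ 1`, `Σ_k ρ_a(k) ≤ S`, `0 ≤ C` ⟹ `|(Mᵀ·diagonal D·M)_{ab}| ≤ C²·S·m`.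
* §3 **`weightedMass_schedule_of_localMass_schedule`**: along a tower, `Σ_{cube k} D_j ≤ m₀·(θ²)^j` + the k-uniform profile ⟹
  `|(M_jᵀ·diagonal D_j·M_j)_{ab}| ≤ (C²·S·m₀)·(θ²)^j` — PART 90 §3's `hW` with `W₀ = C²Sm₀`.
WHAT IT DOES NOT DO: prove the local mass schedule (R9° S1-B–S5-B: Bałaban's squeeze LOCALISED — hole-filling ∕ Caccioppoli on `Δ^η(U) + aQ*Q`, UNTYPED) or the column
profile for Bałaban's minimisers ((H2)-class, [CMP 99-bg] Thm 3.1 (3.42)–(3.47) WITH background — UNTYPED); instantiate anything of Bałaban's.  SUPPLIER work on route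
R6 (rank 2, REDUCTION, no seat); no consumer of record; NEVER «G-an2-4 closed»; NOT (CONV-C), NOT D1, NOT `BetaPertH`, NOT continuum, NOT Clay.  Records:
`HOME/b2b-balaban-gan24-p3/WOODBURY-FIBRE.md` v14.7.
-/

noncomputable section

open Matrix Finset

namespace Summit.QuantumFields.BalabanUV.Beta.GAN24.DerivativeRateTransferJensenMassFreeWeightedGram

/-! ## §1 The weighted Gram of the one-step block means -/

section Gram

variable {μ ν o c : Type*} [Fintype μ] [Fintype ν] [Fintype o] [Fintype c] [DecidableEq μ] [DecidableEq o]

omit [Fintype c] [DecidableEq μ] [DecidableEq o] in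
/-- **`gram_comp`** — the weighted Gram of the minimiser map in the carrier `QfᵀDQf` IS the `D`-Gram of the one-step block means `Qf·ℋ′`:
`ℋ′ᵀ(Qfᵀ·D·Qf)ℋ′ = (Qfℋ′)ᵀ·D·(Qfℋ′)`. [folklore] -/
theorem gram_comp (Hm : Matrix (ν × o) c ℝ) (Qf : Matrix (μ × o) (ν × o) ℝ) (D : Matrix (μ × o) (μ × o) ℝ) :
    Hmᵀ * (Qfᵀ * D * Qf) * Hm = (Qf * Hm)ᵀ * D * (Qf * Hm) := by
  rw [transpose_mul]
  simp only [Matrix.mul_assoc]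

omit [Fintype c] in
/-- **`gram_diagonal_apply`** — for a diagonal weight: `(Mᵀ·diagonal D·M)_{ab} = Σ_p D(p)·M(p,a)·M(p,b)`. [folklore] -/
theorem gram_diagonal_apply (M : Matrix (μ × o) c ℝ) (D : μ × o → ℝ) (a b : c) :
    (Mᵀ * Matrix.diagonal D * M) a b = ∑ p, D p * (M p a * M p b) := by
  rw [Matrix.mul_apply]
  refine Finset.sum_congr rfl fun p _ => ?_
  rw [Matrix.mul_diagonal, Matrix.transpose_apply]
  ring

end Gram

/-! ## §2 LOCAL MASS × COLUMN DECAY ⟹ THE WEIGHTED GRAM BOUND -/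

section Local

variable {μ o c K : Type*} [Fintype μ] [Fintype o] [Fintype c] [Fintype K] [DecidableEq μ] [DecidableEq o] [DecidableEq K]

omit [Fintype c] in
/-- **`abs_gram_diagonal_le_of_colDecay_of_localMass` — THE JUNCTION** [our proof].  Sites `μ × o` grouped into cubes by `blk : μ → K`; a nonnegative weight `D`
with LOCAL mass `Σ_{p : blk p.1 = k} D(p) ≤ m` for every cube `k` (`0 ≤ m`); columns with a k-uniform profile `|M(p,a)| ≤ C·ρ_a(blk p.1)`, `0 ≤ ρ_a ≤ 1`,
`Σ_k ρ_a(k) ≤ S`, `0 ≤ C` ⟹ `|(Mᵀ·diagonal D·M)_{ab}| ≤ C²·S·m`.  (`|Σ_p D·M_a·M_b| ≤ Σ_p D(p)·Cρ_a(blk p)·C = C²·Σ_k ρ_a(k)·Σ_{p ∈ k} D(p) ≤ C²·S·m`.) -/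
theorem abs_gram_diagonal_le_of_colDecay_of_localMass (M : Matrix (μ × o) c ℝ) {D : μ × o → ℝ} (hD : ∀ p, 0 ≤ D p)
    (blk : μ → K) {m C S : ℝ} {ρ : c → K → ℝ} (hm : 0 ≤ m)
    (hmass : ∀ k, ∑ p ∈ Finset.univ.filter (fun p : μ × o => blk p.1 = k), D p ≤ m)
    (hρ0 : ∀ a k, 0 ≤ ρ a k) (hρ1 : ∀ a k, ρ a k ≤ 1) (hS : ∀ a, ∑ k, ρ a k ≤ S) (hC : 0 ≤ C)
    (hcol : ∀ a p, |M p a| ≤ C * ρ a (blk p.1)) (a b : c) :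
    |(Mᵀ * Matrix.diagonal D * M) a b| ≤ C ^ 2 * S * m := by
  rw [gram_diagonal_apply]
  -- pointwise: `|D·M_a·M_b| ≤ C²·D·ρ_a(blk)`
  have hpt : ∀ p : μ × o, |D p * (M p a * M p b)| ≤ C ^ 2 * (D p * ρ a (blk p.1)) := fun p => by
    rw [abs_mul, abs_of_nonneg (hD p), abs_mul]
    have h1 : |M p a| * |M p b| ≤ (C * ρ a (blk p.1)) * (C * 1) := by
      refine mul_le_mul (hcol a p) ((hcol b p).trans ?_) (abs_nonneg _) (mul_nonneg hC (hρ0 _ _))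
      exact mul_le_mul_of_nonneg_left (hρ1 _ _) hC
    have h2 := mul_le_mul_of_nonneg_left h1 (hD p)
    nlinarith
  -- fibrewise: `Σ_p D·ρ_a(blk p) = Σ_k ρ_a(k)·Σ_{p ∈ k} D ≤ S·m`
  have hfib : ∑ p : μ × o, D p * ρ a (blk p.1) ≤ S * m := by
    rw [← Finset.sum_fiberwise Finset.univ (fun p : μ × o => blk p.1) (fun p => D p * ρ a (blk p.1))]
    have hk : ∀ k, ∑ p ∈ Finset.univ.filter (fun p : μ × o => blk p.1 = k), D p * ρ a (blk p.1) ≤ ρ a k * m := fun k => by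
      have e : ∑ p ∈ Finset.univ.filter (fun p : μ × o => blk p.1 = k), D p * ρ a (blk p.1) =
          ρ a k * ∑ p ∈ Finset.univ.filter (fun p : μ × o => blk p.1 = k), D p := by
        rw [Finset.mul_sum]
        refine Finset.sum_congr rfl fun p hp => ?_
        rw [(Finset.mem_filter.mp hp).2, mul_comm]
      rw [e]
      exact mul_le_mul_of_nonneg_left (hmass k) (hρ0 a k)
    calc ∑ k, ∑ p ∈ Finset.univ.filter (fun p : μ × o => blk p.1 = k), D p * ρ a (blk p.1)
        ≤ ∑ k, ρ a k * m := Finset.sum_le_sum fun k _ => hk k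
      _ = (∑ k, ρ a k) * m := by rw [Finset.sum_mul]
      _ ≤ S * m := mul_le_mul_of_nonneg_right (hS a) hm
  calc |∑ p, D p * (M p a * M p b)| ≤ ∑ p, |D p * (M p a * M p b)| := Finset.abs_sum_le_sum_abs _ _
    _ ≤ ∑ p, C ^ 2 * (D p * ρ a (blk p.1)) := Finset.sum_le_sum fun p _ => hpt p
    _ = C ^ 2 * ∑ p, D p * ρ a (blk p.1) := by rw [Finset.mul_sum]
    _ ≤ C ^ 2 * (S * m) := mul_le_mul_of_nonneg_left hfib (sq_nonneg C)
    _ = C ^ 2 * S * m := by ring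

end Local

/-! ## §3 The schedule form along a tower -/

section Tower

variable {c K o : Type*} [Fintype c] [Fintype K] [Fintype o] [DecidableEq K] [DecidableEq o]
variable {μ : ℕ → Type*} [∀ j, Fintype (μ j)] [∀ j, DecidableEq (μ j)]

omit [Fintype c] in
/-- **`weightedMass_schedule_of_localMass_schedule` — PART 90 §3's `hW` FROM A LOCAL MASS SCHEDULE AND A k-UNIFORM COLUMN PROFILE** [our proof]: at every level `j`
the one-step block means `M_j : Matrix (μ_j × o) c ℝ` of the unit-source minimiser columns obey `|M_j(p,a)| ≤ C·ρ_a(blk_j p.1)` (`0 ≤ ρ ≤ 1`, `Σ_k ρ_a(k) ≤ S`,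
`0 ≤ C` — k-UNIFORM), and the nonnegative weights `D_j` have local mass `Σ_{p : blk_j p.1 = k} D_j(p) ≤ m₀·(θ²)^j` in every cube (`0 ≤ m₀`) ⟹
`∀ j a b, |(M_jᵀ·diagonal D_j·M_j)_{ab}| ≤ (C²·S·m₀)·(θ²)^j`. -/
theorem weightedMass_schedule_of_localMass_schedule (M : ∀ j, Matrix (μ j × o) c ℝ) {D : ∀ j, μ j × o → ℝ} (hD : ∀ j p, 0 ≤ D j p)
    (blk : ∀ j, μ j → K) {m₀ C S θ : ℝ} {ρ : c → K → ℝ} (hm₀ : 0 ≤ m₀)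
    (hmass : ∀ j k, ∑ p ∈ Finset.univ.filter (fun p : μ j × o => blk j p.1 = k), D j p ≤ m₀ * (θ ^ 2) ^ j)
    (hρ0 : ∀ a k, 0 ≤ ρ a k) (hρ1 : ∀ a k, ρ a k ≤ 1) (hS : ∀ a, ∑ k, ρ a k ≤ S) (hC : 0 ≤ C)
    (hcol : ∀ j a p, |M j p a| ≤ C * ρ a (blk j p.1)) :
    ∀ j (a b : c), |((M j)ᵀ * Matrix.diagonal (D j) * M j) a b| ≤ (C ^ 2 * S * m₀) * (θ ^ 2) ^ j := by
  intro j a b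
  have hmj : 0 ≤ m₀ * (θ ^ 2) ^ j := mul_nonneg hm₀ (pow_nonneg (sq_nonneg θ) j)
  have h := abs_gram_diagonal_le_of_colDecay_of_localMass (M j) (hD j) (blk j) hmj (hmass j) hρ0 hρ1 hS hC (hcol j) a b
  refine h.trans (le_of_eq ?_)
  ring

end Tower

end Summit.QuantumFields.BalabanUV.Beta.GAN24.DerivativeRateTransferJensenMassFreeWeightedGram

end
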